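import Literature.MathematicalPhysics.QuantumFieldTheory.Balaban1983to89.T4AveragingDisintegration

/-!
# DAG node N11 — THE CONDITIONAL LAW IN A FIBRE CHART (kernel level): on a `V`-dependent charted window, the conditional law of `dU` given `Ū = V`
# IS the chart's Jacobian-weighted fibre measure, `μ`-a.e. `V` — every density at once, `V`-dependent integrands allowed

HEADER — WORK-UNIT METADATA.  Cell `pub-ymgap`, YM-PLAN Track A (HUMAN RULING D-0062), seat `pub-ymgap-dag-n08-w2` (g7; WIDTH SEAT 2∕4 on N08 [B10],
RE-POINTED to N11's [III] §3-supply residue), route `BalabanUVNodes` rev 25, item K1⁷ `StabilityBAtRecordR13SepCoPH` = stmt-QuantumFields-20542 (helper lane,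
`--kind proof --supports 20542 --as helper`, count-neutral).  [I] = [Balaban1987RG1], [III] = [Balaban1988Convergent], [15] = [Balaban1985Variational].
FILE 1 of 2 (generic; FILE 2 `…N11TStepInFibreChart` = the record: `transportOfRecord`, def-T's (†) `tstepOfRecord`, the represented tower's pre-𝐑 slots, the first step).
Over node00-def-T's `T4AveragingDisintegration` (`jointLaw`, `margDensity`, `condLaw`, `kernelTransport`, `jointLaw_eq_withDensity_compProd`, `jointLaw_graph_compl`);
companion of dag-n11-d g14's `…N11KernelTransportInFibreChart` (p610288: the PER-DENSITY identity on a FIXED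
charted set `S ⊆ β`, hypotheses `hpush ∧ hfib` — §1 `chart_of_map_eq_restrict` shows they are the fixed-set case of this file's one hypothesis).

WHY THIS FILE.  def-T's value-level T-step (†) ([III] (3.1) p. 264 as the one-step disintegration transport; `tstepOfRecord_apply`, `slotsTOfRecord_succ_apply`)
  `(𝐓e^A)_{k+1}(s′)(V′) = transportOfRecord k (U ↦ w(s′)(U,V′) · χ_k(init s′)(U) · slot_k(init s′)(U)) (V′)`
reads the transport ON THE DIAGONAL — the integrand DEPENDS ON THE NEW FIELD `V′` through the step weight `w(s′)(U,V′)` (the resummed restrictions (3.2)–(3.3)∕(3.5):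
the small-field window of `U` is centred at the background determined by `V′`) —, and the chart of [III] pp. 267–270 («we remove the δ-functions using the operator C»:
axial gauge ∘ exponential chart at `U₀(V′)` ∘ the linearising transformation (47) of [15]) lives on a `V′`-DEPENDENT window of `U`.  A per-density identity
`kernelTransport ν μ avg ρ =ᵐ[μ] chart(ρ)` (one `ρ` at a time, fixed charted set) does not reach (†): its exceptional null set moves with `ρ = ρ_{V′}`.  THIS FILE types the
KERNEL-LEVEL socket.  A FIBRE CHART OF THE JOINT LAW on a measurable WINDOW `𝒮 ⊆ α × β` (pairs `(V, U)`; slice `𝒮_V = {U | (V,U) ∈ 𝒮}` = the charted set over `V`) is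
`(X, κ, Ψ, J)` — fibre reference `κ : Kernel α X` (s-finite), measurable `Ψ : α × X → β`, Jacobian `J : α × X → ℝ≥0` — with ONE displayed hypothesis
  `hchart : ((μ ⊗ₘ κ).withDensity J).map (z ↦ (z.1, Ψ z)) = (jointLaw ν avg).restrict 𝒮`      («`(V, x) ↦ (V, Ψ(V,x))` charts the joint law of `(Ū, U)` on the window»).
It CONTAINS the graph condition (§1 `ae_ae_avg_chart_eq_of_chart`: the joint law is carried by the graph).  THEN (§3 ★★★), for `μ`-a.e. `V`, AS MEASURES on `β`:
  `(margDensity V) • (condLaw ν avg V)|_{𝒮_V} = ((κ V).withDensity J(V,·)).map Ψ(V,·)`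
— uniqueness of disintegration against every `μ ⊗`-test (§2, jointly measurable `V`-dependent integrands), then a countable π-system through Mathlib's `embeddingReal β`
(no finiteness of the chart kernel needed).  Consequences, `μ`-a.e. in `V` and SIMULTANEOUS IN THE INTEGRAND: `∫⁻`∕`∫` against `condLaw` on the window = the chart integral
for EVERY measurable `g`∕`ρ`, and def-T's `kernelTransport ν μ avg ρ V = ∫ J(V,x)·ρ(Ψ(V,x)) κ_V(dx)` for EVERY measurable `ρ` vanishing off `𝒮_V` — `ρ` may depend on `V`.

WHAT THIS FILE PROVES (0 `def`, 0 `sorry`, standard axioms; generic `{α β X}`).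
§1 `lintegral_jointLaw_eq_lintegral_chart` · ★ `lintegral_graph_eq_lintegral_chart` · `ae_ae_mem_window_of_chart` · `ae_ae_avg_chart_eq_of_chart` · `chart_of_map_eq_restrict`.
§2 ★ `margDensity_mul_lintegral_condLaw_ae_eq_chart` (the diagonal disintegration identity for ONE jointly measurable `V`-dependent `ℝ≥0∞`-integrand, tested on every `t ⊆ α`).
§3 ★★★ `condLaw_restrict_window_ae_eq_chart` · ★★ `ae_forall_lintegral_condLaw_eq_chart` · ★★ `ae_forall_integral_condLaw_eq_chart` · ★★★ `ae_forall_kernelTransport_eq_chart`.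

HONEST FRAMING.  Helper lane of K1⁷; count-neutral; pure finite measure theory (push-forward, `withDensity`, Tonelli ∕ Fubini for `μ ⊗ₘ κ`, a.e. uniqueness, a countable
π-system) over def-T's definitions; NO chart is constructed and NO Jacobian computed — `hchart` is the HYPOTHESIS a Lie–Haar ∕ chart seat discharges; nothing of Bałaban
([I] §2, [III] §3 (3.10)–(3.25), [15] Sect. C (47)–(49)) is asserted; (S-α) ∕ (B4) NOT closed; N11 NOT discharged; N08 untouched; K1⁷ NOT closed; counts unmoved (typed 28∕28 ·
discharged 5∕27).  One finite `𝕋⁴_{L^K}` programme at fixed `ε = L^{−K}`; R4 closes only the conditional finite-𝕋⁴ rung `BalabanLadder.UV` — NOT ℝ⁴, NOT OS, NOT a mass gap,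
NOT Clay.  No `sorry`, `axiom`, `def`, `instance`, `notation`.  Sources (SHAPE ∕ bookkeeping only): [I] (0.4) p.253, Sect. 2 pp.260–262; [III] (2.21) p.258, (3.1) p.264,
(3.2)–(3.5) p.265, p.267 L18–24; [15] (47)–(49) pp.287–288.
-/

noncomputable section

open MeasureTheory ProbabilityTheory
open scoped ENNReal NNReal

namespace Summit.QuantumFields.YangMills.Theorems.BalabanUVNodesN11CondLawInFibreChart

open Literature.MathematicalPhysics.QuantumFieldTheory.Balaban1983to89
open Literature.MathematicalPhysics.QuantumFieldTheory.Balaban1983to89.T4AveragingDisintegration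


/-! ## §1  A fibre chart of the JOINT LAW on a window `𝒮 ⊆ α × β`: the tested (Tonelli) form, the window and the graph a.e., the fixed-set case -/

section JointLaw

variable {α β X : Type*} [MeasurableSpace α] [MeasurableSpace β] [MeasurableSpace X]
variable {ν : Measure β} {μ : Measure α} [SFinite μ] {κ : Kernel α X} [IsSFiniteKernel κ]
variable {avg : β → α} {Ψ : α × X → β} {J : α × X → ℝ≥0} {𝒮 : Set (α × β)}

omit [SFinite μ] [IsSFiniteKernel κ] in
/-- **THE JOINT LAW ON THE WINDOW IN THE COORDINATES `(V, x)`**: under `hchart`, for every measurable `G ≥ 0` on `α × β` vanishing off the window,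
`∫ G d(jointLaw ν avg) = ∫ J(z)·G(z.1, Ψ z) d(μ ⊗ₘ κ)`. [cite: Balaban1987RG1, (0.4) p.253; Balaban1988Convergent, (3.1) p.264, p.267 (bookkeeping: change of variables as a push-forward identity)] -/
theorem lintegral_jointLaw_eq_lintegral_chart (hΨ : Measurable Ψ) (hJ : Measurable J)
    (hchart : ((μ ⊗ₘ κ).withDensity (fun z => (J z : ℝ≥0∞))).map (fun z => (z.1, Ψ z)) = (jointLaw ν avg).restrict 𝒮)
    {G : α × β → ℝ≥0∞} (hG : Measurable G) (hG𝒮 : ∀ w, w ∉ 𝒮 → G w = 0) :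
    ∫⁻ w, G w ∂(jointLaw ν avg) = ∫⁻ z, (J z : ℝ≥0∞) * G (z.1, Ψ z) ∂(μ ⊗ₘ κ) := by
  have hsupp : Function.support G ⊆ 𝒮 := fun w hw => by
    by_contra h
    exact hw (hG𝒮 w h)
  rw [← setLIntegral_eq_of_support_subset hsupp, ← hchart, lintegral_map hG (measurable_fst.prodMk hΨ),
    lintegral_withDensity_eq_lintegral_mul _ (show Measurable fun z : α × X => (J z : ℝ≥0∞) by fun_prop)
      (show Measurable fun z : α × X => G (z.1, Ψ z) from hG.comp (measurable_fst.prodMk hΨ))]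
  rfl

/-- **★ THE TESTED (TONELLI) FORM ON THE DIAGONAL — `∫dU G(Ū, U) = ∫dV ∫κ_V(dx) J(V,x) G(V, Ψ(V,x))`** for every jointly measurable `G ≥ 0` vanishing off the window:
the disintegration of `dU` along `avg` computed in the chart, with the coarse variable ALSO inside the integrand. [cite: Balaban1987RG1, (0.4) p.253; Balaban1988Convergent, (2.21) p.258, (3.1) p.264, p.267] -/
theorem lintegral_graph_eq_lintegral_chart (havg : Measurable avg) (hΨ : Measurable Ψ) (hJ : Measurable J)
    (hchart : ((μ ⊗ₘ κ).withDensity (fun z => (J z : ℝ≥0∞))).map (fun z => (z.1, Ψ z)) = (jointLaw ν avg).restrict 𝒮)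
    {G : α × β → ℝ≥0∞} (hG : Measurable G) (hG𝒮 : ∀ w, w ∉ 𝒮 → G w = 0) :
    ∫⁻ U, G (avg U, U) ∂ν = ∫⁻ V, ∫⁻ x, (J (V, x) : ℝ≥0∞) * G (V, Ψ (V, x)) ∂(κ V) ∂μ := by
  have h1 : ∫⁻ U, G (avg U, U) ∂ν = ∫⁻ w, G w ∂(jointLaw ν avg) := by
    rw [jointLaw, lintegral_map hG (measurable_graphMap havg)]
  rw [h1, lintegral_jointLaw_eq_lintegral_chart hΨ hJ hchart hG hG𝒮,
    Measure.lintegral_compProd (show Measurable fun z : α × X => (J z : ℝ≥0∞) * G (z.1, Ψ z) by fun_prop)]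

/-- **THE CHART LANDS IN THE WINDOW**: for `μ`-a.e. `V`, for `κ_V`-a.e. `x` with `J(V,x) ≠ 0`, `(V, Ψ(V,x)) ∈ 𝒮`. [cite: Balaban1988Convergent, (3.2)–(3.5) p.265 (bookkeeping: the charted window)] -/
theorem ae_ae_mem_window_of_chart (hΨ : Measurable Ψ) (hJ : Measurable J) (h𝒮 : MeasurableSet 𝒮)
    (hchart : ((μ ⊗ₘ κ).withDensity (fun z => (J z : ℝ≥0∞))).map (fun z => (z.1, Ψ z)) = (jointLaw ν avg).restrict 𝒮) :
    ∀ᵐ V ∂μ, ∀ᵐ x ∂(κ V), (J (V, x) : ℝ≥0∞) ≠ 0 → (V, Ψ (V, x)) ∈ 𝒮 := by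
  have h0 : ((μ ⊗ₘ κ).withDensity (fun z => (J z : ℝ≥0∞))) ((fun z => (z.1, Ψ z)) ⁻¹' 𝒮ᶜ) = 0 := by
    rw [← Measure.map_apply (measurable_fst.prodMk hΨ) h𝒮.compl, hchart, Measure.restrict_apply h𝒮.compl,
      Set.compl_inter_self, measure_empty]
  have h1 : ∀ᵐ z ∂((μ ⊗ₘ κ).withDensity (fun z => (J z : ℝ≥0∞))), (z.1, Ψ z) ∈ 𝒮 := by
    rw [ae_iff]
    exact h0
  have h2 : ∀ᵐ z ∂(μ ⊗ₘ κ), (J z : ℝ≥0∞) ≠ 0 → (z.1, Ψ z) ∈ 𝒮 := (ae_withDensity_iff (by fun_prop)).1 h1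
  exact Measure.ae_ae_of_ae_compProd h2

/-- **THE CHART LANDS IN THE FIBRE** (the graph condition is CONTAINED in `hchart`, the joint law being carried by the graph `{(V,U) | V = Ū}`): for `μ`-a.e. `V`, for
`κ_V`-a.e. `x` with `J(V,x) ≠ 0`, `avg (Ψ(V,x)) = V` — dag-n11-d's `hfib`, recovered. [cite: Balaban1987RG1, (0.4) p.253 (the δ-function `δ(ŪV⁻¹)`; bookkeeping)] -/
theorem ae_ae_avg_chart_eq_of_chart [MeasurableEq α] (havg : Measurable avg) (hΨ : Measurable Ψ) (hJ : Measurable J)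
    (hchart : ((μ ⊗ₘ κ).withDensity (fun z => (J z : ℝ≥0∞))).map (fun z => (z.1, Ψ z)) = (jointLaw ν avg).restrict 𝒮) :
    ∀ᵐ V ∂μ, ∀ᵐ x ∂(κ V), (J (V, x) : ℝ≥0∞) ≠ 0 → avg (Ψ (V, x)) = V := by
  have hs : MeasurableSet {w : α × β | w.1 = avg w.2} := measurableSet_eq_fun measurable_fst (havg.comp measurable_snd)
  have h0 : ((μ ⊗ₘ κ).withDensity (fun z => (J z : ℝ≥0∞))) ((fun z => (z.1, Ψ z)) ⁻¹' {w : α × β | w.1 = avg w.2}ᶜ) = 0 := by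
    rw [← Measure.map_apply (measurable_fst.prodMk hΨ) hs.compl, hchart]
    exact nonpos_iff_eq_zero.1 ((Measure.restrict_apply_le _ _).trans (jointLaw_graph_compl ν havg).le)
  have h1 : ∀ᵐ z ∂((μ ⊗ₘ κ).withDensity (fun z => (J z : ℝ≥0∞))), (z.1, Ψ z) ∈ {w : α × β | w.1 = avg w.2} := by
    rw [ae_iff]
    exact h0
  have h2 : ∀ᵐ z ∂(μ ⊗ₘ κ), (J z : ℝ≥0∞) ≠ 0 → (z.1, Ψ z) ∈ {w : α × β | w.1 = avg w.2} :=
    (ae_withDensity_iff (by fun_prop)).1 h1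
  filter_upwards [Measure.ae_ae_of_ae_compProd h2] with V hV
  filter_upwards [hV] with x hx hJx
  exact (hx hJx).symm

omit [SFinite μ] [IsSFiniteKernel κ] in
/-- **THE FIXED-CHARTED-SET CASE IS dag-n11-d's SOCKET**: p610288's two hypotheses `hpush : ((μ ⊗ₘ κ).withDensity J).map Ψ = ν.restrict S` and
`hfib : avg (Ψ z) = z.1` a.e. GIVE `hchart` for the window `𝒮 = Prod.snd⁻¹' S` (the chart composed with the graph map `U ↦ (Ū, U)`).
[cite: Balaban1987RG1, (0.4) p.253; Balaban1988Convergent, p.267 L18–24 (bookkeeping)] -/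
theorem chart_of_map_eq_restrict (havg : Measurable avg) (hΨ : Measurable Ψ) {S : Set β} (hS : MeasurableSet S)
    (hpush : ((μ ⊗ₘ κ).withDensity (fun z => (J z : ℝ≥0∞))).map Ψ = ν.restrict S)
    (hfib : ∀ᵐ z ∂((μ ⊗ₘ κ).withDensity (fun z => (J z : ℝ≥0∞))), avg (Ψ z) = z.1) :
    ((μ ⊗ₘ κ).withDensity (fun z => (J z : ℝ≥0∞))).map (fun z => (z.1, Ψ z)) = (jointLaw ν avg).restrict (Prod.snd ⁻¹' S) := by
  have h1 : (fun z : α × X => (z.1, Ψ z)) =ᵐ[(μ ⊗ₘ κ).withDensity (fun z => (J z : ℝ≥0∞))]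
      fun z => ((fun U : β => (avg U, U)) ∘ Ψ) z := by
    filter_upwards [hfib] with z hz
    simp only [Function.comp_apply, hz]
  rw [Measure.map_congr h1, ← Measure.map_map (measurable_graphMap havg) hΨ, hpush, jointLaw,
    Measure.restrict_map (measurable_graphMap havg) (measurable_snd hS)]
  rfl

end JointLaw

/-! ## §2  The disintegration in the chart ON THE DIAGONAL: one jointly measurable `V`-dependent integrand, `μ`-a.e. in `V` -/

section Diagonal

variable {α β X : Type*} [MeasurableSpace α] [MeasurableSpace β] [MeasurableSpace X]
variable [StandardBorelSpace β] [Nonempty β]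
variable {ν : Measure β} [IsFiniteMeasure ν] {μ : Measure α} [SigmaFinite μ] {κ : Kernel α X} [IsSFiniteKernel κ]
variable {avg : β → α} {Ψ : α × X → β} {J : α × X → ℝ≥0} {𝒮 : Set (α × β)}

/-- **★ THE MARGINAL DENSITY TIMES THE CONDITIONAL INTEGRAL OF A `V`-DEPENDENT INTEGRAND IS THE CHART INTEGRAL, `μ`-a.e.**: under `hchart` and def-T's absolute continuity
`ν.map avg ≪ μ`, for every jointly measurable `G ≥ 0` on `α × β` vanishing off the window,
`h(V) · ∫ G(V,U) condLaw(V,dU) = ∫ J(V,x)·G(V,Ψ(V,x)) κ_V(dx)` for `μ`-a.e. `V` — both sides have the same integral over every measurable `t ⊆ α` (def-T's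
`jointLaw_eq_withDensity_compProd` on the left, §1 on the right, with the integrand `1_t(V)·G(V,U)`). [cite: Balaban1987RG1, (0.4) p.253, Sect. 2 pp.260–262; Balaban1988Convergent, (3.1) p.264, (3.2)–(3.5) p.265, p.267 L18–24] -/
theorem margDensity_mul_lintegral_condLaw_ae_eq_chart (havg : Measurable avg) (hac : ν.map avg ≪ μ) (hΨ : Measurable Ψ) (hJ : Measurable J)
    (hchart : ((μ ⊗ₘ κ).withDensity (fun z => (J z : ℝ≥0∞))).map (fun z => (z.1, Ψ z)) = (jointLaw ν avg).restrict 𝒮)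
    {G : α × β → ℝ≥0∞} (hG : Measurable G) (hG𝒮 : ∀ w, w ∉ 𝒮 → G w = 0) :
    (fun V => (margDensity ν μ avg V : ℝ≥0∞) * ∫⁻ U, G (V, U) ∂(condLaw ν avg V)) =ᵐ[μ]
      fun V => ∫⁻ x, (J (V, x) : ℝ≥0∞) * G (V, Ψ (V, x)) ∂(κ V) := by
  have hm : Measurable fun V => (margDensity ν μ avg V : ℝ≥0∞) := measurable_margDensity.coe_nnreal_ennreal
  have hFm : Measurable fun z : α × X => (J z : ℝ≥0∞) * G (z.1, Ψ z) := by fun_prop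
  refine ae_eq_of_forall_setLIntegral_eq_of_sigmaFinite (hm.mul hG.lintegral_kernel_prod_right') hFm.lintegral_kernel_prod_right'
    fun t ht _ => ?_
  -- the integrand cut down to `t` in the coarse variable
  set Gt : α × β → ℝ≥0∞ := fun w => t.indicator (fun _ => (1 : ℝ≥0∞)) w.1 * G w with hGt
  have hGtm : Measurable Gt := ((measurable_const.indicator ht).comp measurable_fst).mul hG
  have hGt𝒮 : ∀ w, w ∉ 𝒮 → Gt w = 0 := fun w hw => by simp only [hGt, hG𝒮 w hw, mul_zero]
  have e1 : ∀ V, t.indicator (fun V => (margDensity ν μ avg V : ℝ≥0∞) * ∫⁻ U, G (V, U) ∂(condLaw ν avg V)) V =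
      ∫⁻ U, (margDensity ν μ avg V : ℝ≥0∞) * Gt (V, U) ∂(condLaw ν avg V) := by
    intro V
    rw [lintegral_const_mul _ (show Measurable (fun U => Gt (V, U)) from hGtm.comp measurable_prodMk_left)]
    by_cases hV : V ∈ t
    · simp only [hGt, Set.indicator_of_mem hV, one_mul]
    · simp only [hGt, Set.indicator_of_notMem hV, zero_mul, lintegral_zero, mul_zero]
  have e2 : ∀ V, t.indicator (fun V => ∫⁻ x, (J (V, x) : ℝ≥0∞) * G (V, Ψ (V, x)) ∂(κ V)) V =
      ∫⁻ x, (J (V, x) : ℝ≥0∞) * Gt (V, Ψ (V, x)) ∂(κ V) := by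
    intro V
    by_cases hV : V ∈ t
    · simp only [hGt, Set.indicator_of_mem hV, one_mul]
    · simp only [hGt, Set.indicator_of_notMem hV, zero_mul, mul_zero, lintegral_zero]
  have hm2 : Measurable fun z : α × β => (margDensity ν μ avg z.1 : ℝ≥0∞) * Gt z := (hm.comp measurable_fst).mul hGtm
  -- left: through def-T's disintegration `jointLaw = (μ ⊗ₘ condLaw).withDensity (h ∘ fst)`
  have hL : ∫⁻ V in t, (margDensity ν μ avg V : ℝ≥0∞) * ∫⁻ U, G (V, U) ∂(condLaw ν avg V) ∂μ = ∫⁻ w, Gt w ∂(jointLaw ν avg) :=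
    calc ∫⁻ V in t, (margDensity ν μ avg V : ℝ≥0∞) * ∫⁻ U, G (V, U) ∂(condLaw ν avg V) ∂μ
        = ∫⁻ V, t.indicator (fun V => (margDensity ν μ avg V : ℝ≥0∞) * ∫⁻ U, G (V, U) ∂(condLaw ν avg V)) V ∂μ :=
          (lintegral_indicator ht _).symm
      _ = ∫⁻ V, ∫⁻ U, (margDensity ν μ avg V : ℝ≥0∞) * Gt (V, U) ∂(condLaw ν avg V) ∂μ := lintegral_congr e1
      _ = ∫⁻ w, (margDensity ν μ avg w.1 : ℝ≥0∞) * Gt w ∂(μ ⊗ₘ condLaw ν avg) := (Measure.lintegral_compProd hm2).symm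
      _ = ∫⁻ w, Gt w ∂((μ ⊗ₘ condLaw ν avg).withDensity fun z => (margDensity ν μ avg z.1 : ℝ≥0∞)) :=
          (lintegral_withDensity_eq_lintegral_mul _
            (show Measurable (fun z : α × β => (margDensity ν μ avg z.1 : ℝ≥0∞)) from hm.comp measurable_fst) hGtm).symm
      _ = ∫⁻ w, Gt w ∂(jointLaw ν avg) := by rw [← jointLaw_eq_withDensity_compProd ν μ havg hac]
  -- right: through the chart (§1)
  have hR : ∫⁻ V in t, ∫⁻ x, (J (V, x) : ℝ≥0∞) * G (V, Ψ (V, x)) ∂(κ V) ∂μ = ∫⁻ w, Gt w ∂(jointLaw ν avg) :=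
    calc ∫⁻ V in t, ∫⁻ x, (J (V, x) : ℝ≥0∞) * G (V, Ψ (V, x)) ∂(κ V) ∂μ
        = ∫⁻ V, t.indicator (fun V => ∫⁻ x, (J (V, x) : ℝ≥0∞) * G (V, Ψ (V, x)) ∂(κ V)) V ∂μ := (lintegral_indicator ht _).symm
      _ = ∫⁻ V, ∫⁻ x, (J (V, x) : ℝ≥0∞) * Gt (V, Ψ (V, x)) ∂(κ V) ∂μ := lintegral_congr e2
      _ = ∫⁻ z, (J z : ℝ≥0∞) * Gt (z.1, Ψ z) ∂(μ ⊗ₘ κ) :=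
          (Measure.lintegral_compProd (show Measurable fun z : α × X => (J z : ℝ≥0∞) * Gt (z.1, Ψ z) by fun_prop)).symm
      _ = ∫⁻ w, Gt w ∂(jointLaw ν avg) := (lintegral_jointLaw_eq_lintegral_chart hΨ hJ hchart hGtm hGt𝒮).symm
  rw [hL, hR]

end Diagonal

/-! ## §3  THE CONDITIONAL LAW IN THE CHART (kernel level): every density at once -/

section KernelLevel

variable {α β X : Type*} [MeasurableSpace α] [MeasurableSpace β] [MeasurableSpace X]
variable [StandardBorelSpace β] [Nonempty β]
variable {ν : Measure β} [IsFiniteMeasure ν] {μ : Measure α} [SigmaFinite μ] {κ : Kernel α X} [IsSFiniteKernel κ]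
variable {avg : β → α} {Ψ : α × X → β} {J : α × X → ℝ≥0} {𝒮 : Set (α × β)}

/-- **★★★ THE CONDITIONAL LAW OF `U` GIVEN `Ū = V`, ON THE WINDOW, IS THE CHART'S FIBRE MEASURE — `μ`-a.e. `V`, AS MEASURES**:
`(margDensity V) • (condLaw ν avg V)|_{𝒮_V} = ((κ V).withDensity J(V,·)).map Ψ(V,·)` (`𝒮_V = {U | (V,U) ∈ 𝒮}`).  Proof: by §2 the two measures agree, for a.e. `V`, on
each set of the countable π-system `{e⁻¹(]−∞,q]) | q ∈ ℚ}` (`e = embeddingReal β`, a measurable embedding of the standard Borel `β` into `ℝ`) and on `univ` (finite mass: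
`≤ margDensity V`); two finite measures on `ℝ` agreeing there are equal (`ext_of_generate_finite`), and `e` is injective.  No finiteness of the chart kernel is assumed.
[cite: Balaban1987RG1, (0.4) p.253, Sect. 2 pp.260–262; Balaban1988Convergent, (3.1) p.264, (3.2)–(3.5) p.265, p.267 L18–24; Balaban1985Variational, (47)–(49) pp.287–288] -/
theorem condLaw_restrict_window_ae_eq_chart (havg : Measurable avg) (hac : ν.map avg ≪ μ) (hΨ : Measurable Ψ) (hJ : Measurable J)
    (h𝒮 : MeasurableSet 𝒮)
    (hchart : ((μ ⊗ₘ κ).withDensity (fun z => (J z : ℝ≥0∞))).map (fun z => (z.1, Ψ z)) = (jointLaw ν avg).restrict 𝒮) :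
    ∀ᵐ V ∂μ, (margDensity ν μ avg V : ℝ≥0∞) • (condLaw ν avg V).restrict (Prod.mk V ⁻¹' 𝒮) =
      ((κ V).withDensity (fun x => (J (V, x) : ℝ≥0∞))).map (fun x => Ψ (V, x)) := by
  -- (a) the two measures agree on every FIXED measurable `s ⊆ β`, for a.e. `V`
  have key : ∀ s : Set β, MeasurableSet s → ∀ᵐ V ∂μ,
      ((margDensity ν μ avg V : ℝ≥0∞) • (condLaw ν avg V).restrict (Prod.mk V ⁻¹' 𝒮)) s =
        ((κ V).withDensity (fun x => (J (V, x) : ℝ≥0∞))).map (fun x => Ψ (V, x)) s := by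
    intro s hs
    have h𝒮s : MeasurableSet (𝒮 ∩ Prod.snd ⁻¹' s) := h𝒮.inter (measurable_snd hs)
    have hGm : Measurable ((𝒮 ∩ Prod.snd ⁻¹' s).indicator (1 : α × β → ℝ≥0∞)) := measurable_one.indicator h𝒮s
    have hG𝒮 : ∀ w, w ∉ 𝒮 → (𝒮 ∩ Prod.snd ⁻¹' s).indicator (1 : α × β → ℝ≥0∞) w = 0 :=
      fun w hw => Set.indicator_of_notMem (fun h => hw h.1) _
    filter_upwards [margDensity_mul_lintegral_condLaw_ae_eq_chart havg hac hΨ hJ hchart hGm hG𝒮,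
      ae_ae_mem_window_of_chart hΨ hJ h𝒮 hchart] with V hV hVmem
    -- left: `h(V) · condLaw(V) (𝒮_V ∩ s)`
    have eL : ∫⁻ U, (𝒮 ∩ Prod.snd ⁻¹' s).indicator (1 : α × β → ℝ≥0∞) (V, U) ∂(condLaw ν avg V) =
        (condLaw ν avg V) (s ∩ Prod.mk V ⁻¹' 𝒮) := by
      have e : (fun U => (𝒮 ∩ Prod.snd ⁻¹' s).indicator (1 : α × β → ℝ≥0∞) (V, U)) = (s ∩ Prod.mk V ⁻¹' 𝒮).indicator 1 := by
        funext U
        by_cases hU : U ∈ s ∩ Prod.mk V ⁻¹' 𝒮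
        · rw [Set.indicator_of_mem hU, Set.indicator_of_mem (show (V, U) ∈ 𝒮 ∩ Prod.snd ⁻¹' s from ⟨hU.2, hU.1⟩)]
          rfl
        · rw [Set.indicator_of_notMem hU, Set.indicator_of_notMem (fun h => hU ⟨h.2, h.1⟩)]
      rw [e, lintegral_indicator_one (hs.inter (measurable_prodMk_left h𝒮))]
    -- right: the chart measure of `s` (the window indicator is `1` wherever `J ≠ 0`, by `hVmem`)
    have hΨV : Measurable (fun x => Ψ (V, x)) := hΨ.comp measurable_prodMk_left
    have eR : ∫⁻ x, (J (V, x) : ℝ≥0∞) * (𝒮 ∩ Prod.snd ⁻¹' s).indicator (1 : α × β → ℝ≥0∞) (V, Ψ (V, x)) ∂(κ V) =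
        ((κ V).withDensity (fun x => (J (V, x) : ℝ≥0∞))).map (fun x => Ψ (V, x)) s := by
      rw [Measure.map_apply hΨV hs, withDensity_apply _ (hΨV hs), ← lintegral_indicator (hΨV hs)]
      refine lintegral_congr_ae ?_
      filter_upwards [hVmem] with x hx
      by_cases hJx : (J (V, x) : ℝ≥0∞) = 0
      · by_cases hm : x ∈ (fun x => Ψ (V, x)) ⁻¹' s
        · rw [Set.indicator_of_mem hm, hJx, zero_mul]
        · rw [Set.indicator_of_notMem hm, hJx, zero_mul]
      · have hmem := hx hJx
        by_cases hm : Ψ (V, x) ∈ s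
        · rw [Set.indicator_of_mem (show x ∈ (fun x => Ψ (V, x)) ⁻¹' s from hm),
            Set.indicator_of_mem (show (V, Ψ (V, x)) ∈ 𝒮 ∩ Prod.snd ⁻¹' s from ⟨hmem, hm⟩), Pi.one_apply, mul_one]
        · rw [Set.indicator_of_notMem (show x ∉ (fun x => Ψ (V, x)) ⁻¹' s from hm),
            Set.indicator_of_notMem (show (V, Ψ (V, x)) ∉ 𝒮 ∩ Prod.snd ⁻¹' s from fun h => hm h.2), mul_zero]
    rw [Measure.smul_apply, Measure.restrict_apply hs, smul_eq_mul, ← eL, hV, eR]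
  -- (b) a.e. `V`: agreement on the countable π-system `e⁻¹(Iic q)`, `q ∈ ℚ`, and on `univ`
  set e : β → ℝ := embeddingReal β with he_def
  have he : MeasurableEmbedding e := measurableEmbedding_embeddingReal β
  have hrat : ∀ᵐ V ∂μ, ∀ q : ℚ,
      ((margDensity ν μ avg V : ℝ≥0∞) • (condLaw ν avg V).restrict (Prod.mk V ⁻¹' 𝒮)) (e ⁻¹' Set.Iic (q : ℝ)) =
        ((κ V).withDensity (fun x => (J (V, x) : ℝ≥0∞))).map (fun x => Ψ (V, x)) (e ⁻¹' Set.Iic (q : ℝ)) :=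
    ae_all_iff.2 fun q => key _ (he.measurable measurableSet_Iic)
  filter_upwards [hrat, key _ MeasurableSet.univ] with V hVq hVuniv
  set m₁ : Measure β := (margDensity ν μ avg V : ℝ≥0∞) • (condLaw ν avg V).restrict (Prod.mk V ⁻¹' 𝒮) with hm₁
  set m₂ : Measure β := ((κ V).withDensity (fun x => (J (V, x) : ℝ≥0∞))).map (fun x => Ψ (V, x)) with hm₂
  -- both are finite measures
  have h₁fin : m₁ Set.univ < ∞ := by
    rw [hm₁, Measure.smul_apply, smul_eq_mul]
    exact ENNReal.mul_lt_top ENNReal.coe_lt_top (measure_lt_top _ _)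
  haveI : IsFiniteMeasure m₁ := ⟨h₁fin⟩
  haveI : IsFiniteMeasure m₂ := ⟨by rw [← hVuniv]; exact h₁fin⟩
  -- push both to `ℝ` along the embedding and compare on the π-system of rational half-lines
  have hmap : m₁.map e = m₂.map e := by
    refine ext_of_generate_finite (⋃ a : ℚ, {Set.Iic (a : ℝ)}) Real.borel_eq_generateFrom_Iic_rat Real.isPiSystem_Iic_rat ?_ ?_
    · intro s hs
      obtain ⟨q, hq⟩ := Set.mem_iUnion.1 hs
      rw [Set.mem_singleton_iff] at hq
      rw [hq, he.map_apply, he.map_apply]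
      exact hVq q
    · rw [he.map_apply, he.map_apply, Set.preimage_univ]
      exact hVuniv
  ext s hs
  have h := congrArg (fun m : Measure ℝ => m (e '' s)) hmap
  simp only [he.map_apply, he.injective.preimage_image] at h
  exact h

/-- **★★ EVERY `ℝ≥0∞`-DENSITY AT ONCE**: for `μ`-a.e. `V`, for EVERY measurable `g : β → ℝ≥0∞`,
`h(V) · ∫_{𝒮_V} g dcondLaw(V) = ∫ J(V,x)·g(Ψ(V,x)) κ_V(dx)` (integration against the two equal measures of ★★★).
[cite: Balaban1987RG1, (0.4) p.253; Balaban1988Convergent, (3.1) p.264, p.267 L18–24] -/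
theorem ae_forall_lintegral_condLaw_eq_chart (havg : Measurable avg) (hac : ν.map avg ≪ μ) (hΨ : Measurable Ψ) (hJ : Measurable J)
    (h𝒮 : MeasurableSet 𝒮)
    (hchart : ((μ ⊗ₘ κ).withDensity (fun z => (J z : ℝ≥0∞))).map (fun z => (z.1, Ψ z)) = (jointLaw ν avg).restrict 𝒮) :
    ∀ᵐ V ∂μ, ∀ g : β → ℝ≥0∞, Measurable g →
      (margDensity ν μ avg V : ℝ≥0∞) * ∫⁻ U in Prod.mk V ⁻¹' 𝒮, g U ∂(condLaw ν avg V) = ∫⁻ x, (J (V, x) : ℝ≥0∞) * g (Ψ (V, x)) ∂(κ V) := by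
  filter_upwards [condLaw_restrict_window_ae_eq_chart havg hac hΨ hJ h𝒮 hchart] with V hV g hg
  have hJV : Measurable fun x => (J (V, x) : ℝ≥0∞) := (hJ.comp measurable_prodMk_left).coe_nnreal_ennreal
  have hΨV : Measurable (fun x => Ψ (V, x)) := hΨ.comp measurable_prodMk_left
  rw [← smul_eq_mul, ← lintegral_smul_measure, hV, lintegral_map hg hΨV,
    lintegral_withDensity_eq_lintegral_mul _ hJV (show Measurable (fun x => g (Ψ (V, x))) from hg.comp hΨV)]
  rfl

/-- **★★ EVERY REAL DENSITY AT ONCE**: for `μ`-a.e. `V`, for EVERY measurable `ρ : β → ℝ` (integrable or not — both sides are then `0` together),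
`h(V) · ∫_{𝒮_V} ρ dcondLaw(V) = ∫ J(V,x)·ρ(Ψ(V,x)) κ_V(dx)`. [cite: Balaban1987RG1, (0.4) p.253; Balaban1988Convergent, (3.1) p.264, p.267 L18–24] -/
theorem ae_forall_integral_condLaw_eq_chart (havg : Measurable avg) (hac : ν.map avg ≪ μ) (hΨ : Measurable Ψ) (hJ : Measurable J)
    (h𝒮 : MeasurableSet 𝒮)
    (hchart : ((μ ⊗ₘ κ).withDensity (fun z => (J z : ℝ≥0∞))).map (fun z => (z.1, Ψ z)) = (jointLaw ν avg).restrict 𝒮) :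
    ∀ᵐ V ∂μ, ∀ ρ : β → ℝ, Measurable ρ →
      (margDensity ν μ avg V : ℝ) * ∫ U in Prod.mk V ⁻¹' 𝒮, ρ U ∂(condLaw ν avg V) = ∫ x, (J (V, x) : ℝ) * ρ (Ψ (V, x)) ∂(κ V) := by
  filter_upwards [condLaw_restrict_window_ae_eq_chart havg hac hΨ hJ h𝒮 hchart] with V hV ρ hρ
  have hJV : Measurable fun x => J (V, x) := hJ.comp measurable_prodMk_left
  have hΨV : Measurable (fun x => Ψ (V, x)) := hΨ.comp measurable_prodMk_left
  have h1 : (margDensity ν μ avg V : ℝ) * ∫ U in Prod.mk V ⁻¹' 𝒮, ρ U ∂(condLaw ν avg V) =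
      ∫ U, ρ U ∂((margDensity ν μ avg V : ℝ≥0∞) • (condLaw ν avg V).restrict (Prod.mk V ⁻¹' 𝒮)) := by
    rw [integral_smul_measure, ENNReal.coe_toReal, smul_eq_mul]
  rw [h1, hV, integral_map hΨV.aemeasurable hρ.aestronglyMeasurable, integral_withDensity_eq_integral_smul hJV]
  refine integral_congr_ae (ae_of_all _ fun x => ?_)
  show J (V, x) • ρ (Ψ (V, x)) = (J (V, x) : ℝ) * ρ (Ψ (V, x))
  rw [NNReal.smul_def, smul_eq_mul]

/-- **★★★ def-T's DISINTEGRATION TRANSPORT IN THE CHART, EVERY DENSITY AT ONCE**: for `μ`-a.e. `V`, for EVERY measurable real `ρ` vanishing off the window slice `𝒮_V`,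
`kernelTransport ν μ avg ρ V = ∫ J(V,x)·ρ(Ψ(V,x)) κ_V(dx)`.  The exceptional null set does NOT depend on `ρ`, so `ρ = ρ_V` may depend on `V` (the case of def-T's (†), §4) —
the uniform-in-`ρ`, windowed sharpening of dag-n11-d's `kernelTransport_ae_eq_integral_chart_of_support`.
[cite: Balaban1987RG1, (0.4) p.253, Sect. 2 pp.260–262; Balaban1988Convergent, (3.1) p.264, (3.2)–(3.5) p.265, p.267 L18–24; Balaban1985Variational, (47)–(49) pp.287–288] -/
theorem ae_forall_kernelTransport_eq_chart (havg : Measurable avg) (hac : ν.map avg ≪ μ) (hΨ : Measurable Ψ) (hJ : Measurable J)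
    (h𝒮 : MeasurableSet 𝒮)
    (hchart : ((μ ⊗ₘ κ).withDensity (fun z => (J z : ℝ≥0∞))).map (fun z => (z.1, Ψ z)) = (jointLaw ν avg).restrict 𝒮) :
    ∀ᵐ V ∂μ, ∀ ρ : β → ℝ, Measurable ρ → (∀ U, (V, U) ∉ 𝒮 → ρ U = 0) →
      kernelTransport ν μ avg ρ V = ∫ x, (J (V, x) : ℝ) * ρ (Ψ (V, x)) ∂(κ V) := by
  filter_upwards [ae_forall_integral_condLaw_eq_chart havg hac hΨ hJ h𝒮 hchart] with V hV ρ hρ hρ𝒮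
  rw [← hV ρ hρ, setIntegral_eq_integral_of_forall_compl_eq_zero (s := Prod.mk V ⁻¹' 𝒮) fun U hU => hρ𝒮 U hU]
  rfl

end KernelLevel

end Summit.QuantumFields.YangMills.Theorems.BalabanUVNodesN11CondLawInFibreChart

end
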